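import Mathlib
import HarnessLib
import Summits.Ventures.LatticeQCDFlow.Exactness.SpectralCouplingLayerEquiv
import Summits.Ventures.LatticeQCDFlow.Exactness.KernelCouplingMask

/-!
# The `SU(N)` spectral PLAQUETTE coupling layer on the lattice with invertible eigenvalue flows is a homeomorphism and a measurable automorphism of the gauge-field space

HONEST FRAMING: exact (Metropolis-corrected) sampling algorithms for lattice gauge theory;
figures of merit are autocorrelation/cost numbers at stated couplings and volumes; no
continuum-physics claim.

Venture `LatticeQCDFlow` (cell pub-lqcd), topic `Exactness`; FANOUT row 10 (`eng-equiv`, engine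
`latflow.equiv` `spectral.SUNSpectralCoupling.forward` / `.inverse` on `lattice.py` under `masks.py`
direction masks; Boyda et al., PRD 103 (2021) 074504 §III.C).  NEW WORK of the cell: the LATTICE
twins of `SpectralCouplingLayerEquiv.isHomeomorph_spectralCouplingLayer` /
`exists_measurableEquiv_spectralCouplingLayer` (abstract link set, abstract continuous staple), through
the bridge `KernelCouplingMask.plaquetteKernelLayer_eq_coupleFun` (frozen staples ⟹ the plaquette kernel
layer IS `Theory2.coupleFun` with the staple read continuously off the frozen links).  The forward map
of the produced `GaugeConfig d L SU(n) ≃ᵐ GaugeConfig d L SU(n)` IS the layer — the hypothesis of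
`HasJacobian.map_withDensity_equiv` (the sampler's model density) and of the FT-HMC theorems; the
inverse (the engine's `inverse` pass, kernel of the inverse eigenvalue map) is never evaluated by a
sampler but must exist measurably.  Nothing is cited as a fact; no number; no definition.

* **`isHomeomorph_spectralPlaquetteLayer_sun`**, **`exists_measurableEquiv_spectralPlaquetteLayer_sun`**
  — lattice `(ℤ/L)^d`, links in `SU(n)`; mask `p` / planes `ν` with the three staple links of every
  active plaquette frozen; kernel field reading frozen links, following the spectral recipe of
  eigenvalue maps `f e y` (jointly continuous on frozen links × unimodular torus) that have two-sided
  inverses `g e y` on admissible tuples realised by kernels `h' e y` ⟹ the layer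
  `V e ↦ h_e(P) P⁻¹ V e` is a homeomorphism of `GaugeConfig d L SU(n)` and `⇑Ψ` for a measurable
  automorphism `Ψ`.
-/

noncomputable section

namespace Summit.Ventures.LatticeQCDFlow.Exactness

open Matrix
open Literature.LinearAlgebra.Matrix
open Literature.MathematicalPhysics.QuantumFieldTheory

variable {n : Type*} [Fintype n] [DecidableEq n] {d L : ℕ} [NeZero L]
  (p : Edge d L → Prop) [DecidablePred p] (ν : Edge d L → Fin d)
  (h1 : ∀ e, p e → ¬p (e.1.shift e.2, ν e)) (h2 : ∀ e, p e → ¬p (e.1.shift (ν e), e.2))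
  (h3 : ∀ e, p e → ¬p (e.1, ν e))
  (hol : GaugeConfig d L (Matrix.specialUnitaryGroup n ℂ) → Edge d L →
    Matrix.specialUnitaryGroup n ℂ → Matrix.specialUnitaryGroup n ℂ)
  (h h' : Edge d L → ({f : Edge d L // ¬p f} → Matrix.specialUnitaryGroup n ℂ) →
    Matrix.specialUnitaryGroup n ℂ → Matrix.specialUnitaryGroup n ℂ)
  (hHV : ∀ V e, p e → hol V e = h e (fun f => V f))
  (f g : Edge d L → ({f : Edge d L // ¬p f} → Matrix.specialUnitaryGroup n ℂ) → (n → ℂ) → (n → ℂ))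
  (hf : ∀ e, ContinuousOn
    (fun q : ({f : Edge d L // ¬p f} → Matrix.specialUnitaryGroup n ℂ) × (n → ℂ) => f e q.1 q.2)
    {q | ∀ i, ‖q.2 i‖ = 1})
  (hagree : ∀ e y (P : Matrix.specialUnitaryGroup n ℂ) (V : Matrix n n ℂ) (dg : n → ℂ),
    V ∈ Matrix.unitaryGroup n ℂ → (P : Matrix n n ℂ) = V * diagonal dg * star V →
      ((h e y P : Matrix.specialUnitaryGroup n ℂ) : Matrix n n ℂ) = V * diagonal (f e y dg) * star V)
  (hagree' : ∀ e y (P : Matrix.specialUnitaryGroup n ℂ) (V : Matrix n n ℂ) (dg : n → ℂ),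
    V ∈ Matrix.unitaryGroup n ℂ → (P : Matrix n n ℂ) = V * diagonal dg * star V →
      ((h' e y P : Matrix.specialUnitaryGroup n ℂ) : Matrix n n ℂ) = V * diagonal (g e y dg) * star V)
  (hgf : ∀ e y (dg : n → ℂ), (∀ i, ‖dg i‖ = 1) → ∏ i, dg i = 1 → g e y (f e y dg) = dg)
  (hfg : ∀ e y (dg : n → ℂ), (∀ i, ‖dg i‖ = 1) → ∏ i, dg i = 1 → f e y (g e y dg) = dg)

include h1 h2 h3 hHV hf hagree hagree' hgf hfg

omit [NeZero L] in
/-- **Boyda's `SU(N)` spectral plaquette coupling layer on the lattice is a homeomorphism** of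
`GaugeConfig d L SU(n)` when every per-link eigenvalue flow is invertible (frozen staples, recipe,
joint continuity as stated). -/
theorem isHomeomorph_spectralPlaquetteLayer_sun :
    IsHomeomorph (fun (V : GaugeConfig d L (Matrix.specialUnitaryGroup n ℂ)) (e : Edge d L) =>
      if p e then hol V e (plaquetteHolonomy V e.1 e.2 (ν e)) * (plaquetteHolonomy V e.1 e.2 (ν e))⁻¹ * V e
      else V e) := by
  have hev : ∀ f₀ : {f : Edge d L // ¬p f},
      Continuous fun y : ({f : Edge d L // ¬p f} → Matrix.specialUnitaryGroup n ℂ) => y f₀ :=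
    fun f₀ => continuous_apply f₀
  have hS : ∀ a : {e // p e}, Continuous fun y : ({f : Edge d L // ¬p f} → Matrix.specialUnitaryGroup n ℂ) =>
      y ⟨_, h1 a.1 a.2⟩ * (y ⟨_, h2 a.1 a.2⟩)⁻¹ * (y ⟨_, h3 a.1 a.2⟩)⁻¹ := fun a =>
    ((hev _).mul (hev _).inv).mul (hev _).inv
  rw [plaquetteKernelLayer_eq_coupleFun p ν hol h hHV h1 h2 h3]
  exact isHomeomorph_coupleFun
    (fun a y => kernelUpdate_bijective
      (spectralKernel_specialUnitaryGroup_bijective (hagree a.1 y) (hagree' a.1 y) (hgf a.1 y) (hfg a.1 y))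
      (y ⟨_, h1 a.1 a.2⟩ * (y ⟨_, h2 a.1 a.2⟩)⁻¹ * (y ⟨_, h3 a.1 a.2⟩)⁻¹))
    fun a => continuous_kernelUpdate (h := h a.1)
      (S := fun y : ({f : Edge d L // ¬p f} → Matrix.specialUnitaryGroup n ℂ) =>
        y ⟨_, h1 a.1 a.2⟩ * (y ⟨_, h2 a.1 a.2⟩)⁻¹ * (y ⟨_, h3 a.1 a.2⟩)⁻¹)
      (continuous_spectralKernel_specialUnitaryGroup_param (hf a.1) (hagree a.1)) (hS a)

/-- **… and `⇑Ψ` for a measurable automorphism `Ψ : GaugeConfig d L SU(n) ≃ᵐ GaugeConfig d L SU(n)`**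
(Borel structures; the layer is a measurable bijection with measurable inverse). -/
theorem exists_measurableEquiv_spectralPlaquetteLayer_sun :
    ∃ Ψ : GaugeConfig d L (Matrix.specialUnitaryGroup n ℂ) ≃ᵐ GaugeConfig d L (Matrix.specialUnitaryGroup n ℂ),
      ⇑Ψ = fun (V : GaugeConfig d L (Matrix.specialUnitaryGroup n ℂ)) (e : Edge d L) =>
        if p e then hol V e (plaquetteHolonomy V e.1 e.2 (ν e)) * (plaquetteHolonomy V e.1 e.2 (ν e))⁻¹ * V e
        else V e := by
  obtain ⟨Φ, hΦ⟩ := isHomeomorph_iff_exists_homeomorph.mp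
    (isHomeomorph_spectralPlaquetteLayer_sun p ν h1 h2 h3 hol h h' hHV f g hf hagree hagree' hgf hfg)
  haveI : SecondCountableTopology (Matrix n n ℂ) := inferInstanceAs (SecondCountableTopology (n → n → ℂ))
  haveI : SecondCountableTopology (Matrix.specialUnitaryGroup n ℂ) :=
    Topology.IsEmbedding.subtypeVal.secondCountableTopology
  exact ⟨Φ.toMeasurableEquiv, by rw [Homeomorph.toMeasurableEquiv_coe, hΦ]⟩

end Summit.Ventures.LatticeQCDFlow.Exactness
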